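import Summits.QuantumFields.BalabanUV.T4Continuum.Support.ShellMeasureWilsonRealizedSUNWords
import Summits.QuantumFields.BalabanUV.T4Continuum.Support.ShellMeasureExpHaarClosedBallSUN
import Literature.MathematicalPhysics.QuantumFieldTheory.Balaban1983to89.MissingProofs

/-!
# `T4Continuum.ShellMeasureWilsonRealizedSUN` — (M1)₀ REALIZED for `G = SU(N)`, EVERY `N`, file 2 of 2: the windowed,
# sectioned Wilson block weight on the cell's configuration space `(fieldMeasure P j SU(N)).withDensity F` and the
# verbatim classifier `max_p dist1 U(∂p)` satisfy `T4ShellMeasure.SlotAntiConcentration` — no analytic binder left,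
# no chart-identity binder left
# (cell `pub-balaban`, sub-cell `t4`, spine estimate NE7c (node U5b); ROUND-2 crew `t4-ne7c-formalise-*`, seat
# `b2b-balaban-t4-ne7c-formalise-leaf-10` (gen 7); OFFERED leaf «(M1)₀ REALIZED FOR SU(N) — THE LEVEL-0 FACE OF THE
# SU(N) ROAD» (journal `CLAIMS.log` l.12031; orbit of rows S3∕S30∕S31 of `t4/b2b-balaban-t4-ne7c-p1/LEAVES-NE7c-P1.md`,
# trigger `t4/T4-NE7c-TRIGGER.json` c5: optional — `SU(2)` is the row's certified instance); the `SU(N)` twin, WORD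
# FOR WORD, of `ShellMeasureWilsonRealizedSU2` (lineage t4-ne7c-p1 gen 25, p206694); ADDITIVE — imports file 1
# `ShellMeasureWilsonRealizedSUNWords`, `ShellMeasureExpHaarClosedBallSUN` (the (CH)₁-free `SU(N)` engine, p215095)
# and the tree's `MissingProofs` (measurability of `U ↦ U(∂p)`) only and modifies nothing; 0 sorry, 0 citations, no
# `def … : Prop`)

HONEST FRAMING.  Finite four-torus programme, rung (B)+1 only — NOT infinite volume, NOT a mass gap, NOT the Clay
problem, NOT summit progress; (B), `BetaPertHyp`, (B^μ) not consumed.  (M1) for BAŁABAN'S INDUCTIVELY DEFINED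
EFFECTIVE MEASURES is NOT PRINTED (GAPS G-ne7cp1-1) and NOT moved: this is the LEVEL-0 instance for the gauge group
`SU(N)` (bare Wilson step: the tested variable of B14 (2.17) is the bare plaquette field `U_{0,□}(V) = V`, the weight
is the Wilson weight of B12 (0.2)), WITH the small-field window placed on the block's BOND variables — the bondwise
image window `windowSU Λ 1 S` of the `SU(N)` road (every block bond in `exp(B̄_S)`, `B̄_S` the closed Hilbert–Schmidt
ball of radius `S` in `𝔰𝔲(N)`; the located (LR) «window insertion after the axial gauge» is ASSUMED in the form of the
weight, not proved) — and WITHOUT exterior co-tests (the located (MR) untouched; the frozen exterior is arbitrary, so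
each exterior letter's deviation is bounded by `2`, not by a small-field size — hence the constant below is linear,
not quadratic, in `S`).  Level 0 is in NE7c's live window only for `K ≤ N₁`.  Trigger c3: (M1)₀ realized ≠ NE7c;
NOTHING in the countdown moves; `SU(2)` stays the certified instance (c5).  0 sorry, 0 citations; the series enters
only through the DEFINITIONS `Setup.plaqHol`, `1 − reTr`, `dist1` (B12 (0.2), B7 (19)) and the cell's `UnitaryModel`
instances for `SU(N)`, by `rfl` (`ShellMeasureWilsonBlock.wilson_dictionary_specialUnitaryGroup`).  HONEST DEPENDENCY
(cell): continuum YM on T⁴ ⇐ BetaPertH ∧ nine spine estimates (0/9 proved); BetaPertH ⇐ (D1) ∧ (D4) ∧ CAP+tail;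
G-an2-4 gates asym, D1 and NE2/3/4.

THE THEOREM (`slotAntiConcentration_wilson_suN`).  Lattice `T^{(j)}` of the cell (`Params P`, any `j`), `G = SU(N)`,
any `N ≥ 1`; a block `Λ` of bonds (block chart space `BlockChartSU N Λ = Λ → ℝ^{d_N}`, `d_N = dimSU N = dim 𝔰𝔲(N)`,
`#Λ·d_N` real coordinates); window radius `0 ≤ S ≤ 1/4`; classifier plaquettes `P_u ≠ ∅` with all four bonds in `Λ`;
weight plaquettes `P_w`; `β ≥ 0`; `θ > 0`, `0 ≤ δ < 1`, `0 ≤ ρ ≤ (1−δ)/2`; (SM)₀ `4·(4S)²·e^{8S} ≤ δθ`.  WEIGHT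
`wilsonF = windowSU Λ 1 S (U|_Λ) · exp(−β Σ_{p∈P_w}(1 − reTr U(∂p)))`, CLASSIFIER `wilsonU = max_{p∈P_u} dist1 U(∂p)`.
CONCLUSION:
`SlotAntiConcentration ((fieldMeasure P j SU(N)).withDensity wilsonF) wilsonU θ ρ (2·(#Λ·d_N + β·#P_w·4S·(8 + 16S))/(1−δ))`.
PROOF = the (CH)₁-FREE `SU(N)` engine `ShellMeasureExpHaarClosedBallSUN.slotAntiConcentration_realized_suN_le`
(chart identity a THEOREM of the tree for every `N`, Jacobian and window ride free) with (S-i)₀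
`ShellMeasureWilsonWords.coreMap_sup` and (S-ii)₀ `ShellMeasureWilsonBlock.wilsonAction_contract_sub_le`, after the
dictionary of file 1 (`coe_plaqHol_eq_wordEval`, `wordEval_plaqWord_smul`; generator sizes `≤ S` per bond from
`‖X‖_op ≤ ‖X‖_HS`).  Compared with `SU(2)` (cube of half-side `S`, sizes `2S` per bond): `n = 3·#Λ ↦ #Λ·d_N`,
`8S ↦ 4S`, `3S² < π² ↦ S ≤ 1/4 (≤ π)`.  It is derived (exterior factor `1`) from
`slotAntiConcentration_wilson_suN_exterior`: the SAME conclusion and constant for the density `wilsonF · Gx` with ANY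
measurable Λ-BLIND exterior factor `Gx ≤ 1` (`Gx (V[Λ := y]) = Gx V`: exterior co-tests, exterior Boltzmann weights)
riding free — the `SU(N)` counterpart of `ShellMeasureWilsonExterior.slotAntiConcentration_wilson_su2_exterior`.

WHAT THIS DOES NOT DO.  (LR)₀, (MR)₀, anything at `j ≥ 1`; NE7c NOT proved; 0/9 spine.
-/

noncomputable section

open NormedSpace Set Function MeasureTheory Metric

namespace Summit.QuantumFields.BalabanUV.T4Continuum.ShellMeasureWilsonRealizedSUN

open scoped ENNReal Matrix.Norms.L2Operator
open Literature.MathematicalPhysics.QuantumFieldTheory.Balaban1983to89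
open T4ShellMeasure (SlotAntiConcentration)
open T4ShellMeasureDet (blockLaw)
open ShellMeasureExpChartSUN
open ShellMeasureScalingSUN (windowSU measurable_windowSU windowSU_le_one)
open ShellMeasureExpHaarClosedBallSUN (slotAntiConcentration_realized_suN_le)
open ShellMeasureWilsonWords (scale normSum wordExp coreMap_sup interpConst_mono depth_admissible normSum_nonneg
  scale_one)
open ShellMeasureWilsonTrace (Letter wordEval sGen dFro TraceData)
open ShellMeasureWilsonBlock (matrixTrace matrixTrace_N_pos wilsonAction_contract_sub_le
  wilson_dictionary_specialUnitaryGroup)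

variable {N : ℕ} [NeZero N] {P : Params} {j : ℕ} [DecidableEq (PBond P j)]
variable (Λ : Finset (PBond P j))

/-! ## §2 The realized objects: sectioned Wilson weight, windowed density, classifier -/

/-- THE SECTIONED WILSON WEIGHT of the block at exterior `V`: `R V y = exp(−β Σ_{p∈P_w} (1 − reTr (V[Λ := y])(∂p)))`.
[folklore] -/
def wilsonR (β : ℝ) (Pw : Finset (Plaq P j)) (V : GaugeField P j (SUN N)) (y : ↥Λ → SUN N) : ℝ≥0∞ :=
  ENNReal.ofReal (Real.exp (-(β * ∑ p ∈ Pw, (1 - reTr (GaugeField.plaqHol (updateFinset V Λ y) p)))))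

/-- THE REALIZED DENSITY: the bondwise image window of radius `S` about `1` on the block bonds
(`ShellMeasureScalingSUN.windowSU`, read on the restriction of the configuration to `Λ`) times the Wilson weight
(exterior bonds free). [folklore] -/
def wilsonF (S β : ℝ) (Pw : Finset (Plaq P j)) (V : GaugeField P j (SUN N)) : ℝ≥0∞ :=
  windowSU Λ (1 : GaugeField P j (SUN N)) S (fun b : ↥Λ => V b) *
    ENNReal.ofReal (Real.exp (-(β * ∑ p ∈ Pw, (1 - reTr (GaugeField.plaqHol V p)))))

/-- THE VERBATIM LEVEL-0 CLASSIFIER `u(V) = max_{p ∈ P_u} dist1 V(∂p)` (B14 (2.17) at `k = 0`, operator norm). [folklore] -/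
def wilsonU {Pu : Finset (Plaq P j)} (hPu : Pu.Nonempty) (V : GaugeField P j (SUN N)) : ℝ :=
  Pu.sup' hPu fun p => dist1 (GaugeField.plaqHol V p)

omit [DecidableEq (PBond P j)] in
/-- the Wilson sum is measurable. [folklore] -/
theorem measurable_wilsonSum (Pw : Finset (Plaq P j)) :
    Measurable fun V : GaugeField P j (SUN N) => ∑ p ∈ Pw, (1 - reTr (GaugeField.plaqHol V p)) := by
  refine Finset.measurable_sum _ fun p _ => ?_
  exact measurable_const.sub (RegularGaugeGroup.measurable_reTr.comp (Missing.measurable_plaqHol p))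

omit [DecidableEq (PBond P j)] in
/-- the Wilson sum is non-negative. [folklore] -/
theorem wilsonSum_nonneg (Pw : Finset (Plaq P j)) (V : GaugeField P j (SUN N)) :
    0 ≤ ∑ p ∈ Pw, (1 - reTr (GaugeField.plaqHol V p)) :=
  Finset.sum_nonneg fun _ _ => sub_nonneg.2 (GaugeGroup.reTr_le_one _)

/-- `R V` is measurable. [folklore] -/
theorem measurable_wilsonR (β : ℝ) (Pw : Finset (Plaq P j)) (V : GaugeField P j (SUN N)) :
    Measurable (wilsonR Λ β Pw V) := by
  unfold wilsonR
  refine ENNReal.measurable_ofReal.comp (Real.measurable_exp.comp ?_)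
  exact ((measurable_const.mul ((measurable_wilsonSum Pw).comp measurable_updateFinset))).neg

omit [NeZero N] [DecidableEq (PBond P j)] in
/-- the restriction of a configuration to the block bonds is measurable. [folklore] -/
theorem measurable_restrictBlock : Measurable fun V : GaugeField P j (SUN N) => fun b : ↥Λ => V b :=
  measurable_pi_lambda _ fun b => measurable_pi_apply (b : PBond P j)

omit [DecidableEq (PBond P j)] in
/-- `F` is measurable. [folklore] -/
theorem measurable_wilsonF (S β : ℝ) (Pw : Finset (Plaq P j)) : Measurable (wilsonF Λ S β Pw (N := N)) := by
  unfold wilsonF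
  refine ((measurable_windowSU Λ 1 S).comp (measurable_restrictBlock Λ)).mul ?_
  exact ENNReal.measurable_ofReal.comp (Real.measurable_exp.comp ((measurable_const.mul (measurable_wilsonSum Pw))).neg)

omit [DecidableEq (PBond P j)] in
/-- `u` is measurable. [folklore] -/
theorem measurable_wilsonU {Pu : Finset (Plaq P j)} (hPu : Pu.Nonempty) :
    Measurable (wilsonU hPu (P := P) (j := j) (N := N)) := by
  have h : wilsonU hPu (P := P) (j := j) (N := N) =
      Pu.sup' hPu (fun p => fun V : GaugeField P j (SUN N) => dist1 (GaugeField.plaqHol V p)) := by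
    funext V; simp [wilsonU, Finset.sup'_apply]
  rw [h]
  exact Finset.measurable_sup' hPu fun p _ => RegularGaugeGroup.measurable_dist1.comp (Missing.measurable_plaqHol p)

omit [NeZero N] in
/-- on the section through `V` the restriction to the block IS the section variable. [folklore] -/
theorem restrictBlock_updateFinset (V : GaugeField P j (SUN N)) (y : ↥Λ → SUN N) :
    (fun b : ↥Λ => updateFinset V Λ y b) = y := by
  funext b
  simp [updateFinset, b.2]

/-- THE WINDOW FACTORISATION `hFw` of the realized headline: the window reads the block bonds only. [folklore] -/
theorem wilsonF_updateFinset (S β : ℝ) (Pw : Finset (Plaq P j)) (V : GaugeField P j (SUN N)) (y : ↥Λ → SUN N) :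
    wilsonF Λ S β Pw (updateFinset V Λ y) =
      windowSU Λ ((fun _ => (1 : GaugeField P j (SUN N))) V) S y * wilsonR Λ β Pw V y := by
  unfold wilsonF wilsonR
  rw [restrictBlock_updateFinset]

omit [DecidableEq (PBond P j)] in
/-- the realized density is at most `1` (`β ≥ 0`). [folklore] -/
theorem wilsonF_le_one {S β : ℝ} (hβ : 0 ≤ β) (Pw : Finset (Plaq P j)) (V : GaugeField P j (SUN N)) :
    wilsonF Λ S β Pw V ≤ 1 := by
  unfold wilsonF
  have h1 : windowSU Λ (1 : GaugeField P j (SUN N)) S (fun b : ↥Λ => V b) ≤ 1 := windowSU_le_one Λ 1 S _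
  have h2 : ENNReal.ofReal (Real.exp (-(β * ∑ p ∈ Pw, (1 - reTr (GaugeField.plaqHol V p))))) ≤ 1 := by
    rw [ENNReal.ofReal_le_one, Real.exp_le_one_iff, neg_nonpos]
    exact mul_nonneg hβ (wilsonSum_nonneg Pw V)
  calc _ ≤ (1 : ℝ≥0∞) * 1 := mul_le_mul' h1 h2
    _ = 1 := one_mul _

/-- per-section finiteness `hfin` of the realized headline. [folklore] -/
theorem wilsonF_section_fin {S β : ℝ} (hβ : 0 ≤ β) (Pw : Finset (Plaq P j)) (V : GaugeField P j (SUN N)) :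
    ((blockLaw Λ).withDensity fun y : ↥Λ → SUN N => wilsonF Λ S β Pw (updateFinset V Λ y)) univ ≠ ∞ := by
  rw [withDensity_apply _ MeasurableSet.univ, Measure.restrict_univ]
  refine ne_top_of_le_ne_top (b := (blockLaw (G := SUN N) Λ) univ) (measure_ne_top _ _) ?_
  calc ∫⁻ y, wilsonF Λ S β Pw (updateFinset V Λ y) ∂blockLaw Λ ≤ ∫⁻ _y, 1 ∂blockLaw (G := SUN N) Λ :=
        lintegral_mono fun y => wilsonF_le_one Λ hβ Pw _
    _ = (blockLaw (G := SUN N) Λ) univ := lintegral_one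

/-! ## §3 Dictionary: the realized action and classifier on the fibre are the sectioned words -/

/-- the Wilson energy of the sectioned configuration at `chart (c • x)` is the word energy at parameter `c`.
[folklore] -/
theorem wilsonSum_chart_smul (Pw : Finset (Plaq P j)) (V : GaugeField P j (SUN N)) (x : BlockChartSU N Λ) (c : ℝ) :
    ∑ p ∈ Pw, (1 - reTr (GaugeField.plaqHol (updateFinset V Λ (expFibreChartSU Λ 1 (c • x))) p)) =
      ∑ p ∈ Pw, (1 - (matrixTrace (n := Fin N)).τ (wordEval c (plaqWord Λ V x p)) / (matrixTrace (n := Fin N)).N) := by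
  refine Finset.sum_congr rfl fun p _ => ?_
  rw [← (wilson_dictionary_specialUnitaryGroup _).1, coe_plaqHol_eq_wordEval, wordEval_plaqWord_smul]

variable [DecidableEq (Plaq P j)]

/-- the classifier of the sectioned configuration at `chart (c • x)`, for INTERIOR plaquettes, is the max of the
scaled words of exponentials. [folklore] -/
theorem wilsonU_chart_smul {Pu : Finset (Plaq P j)} (hPu : Pu.Nonempty)
    (hPuΛ : ∀ p ∈ Pu, (⟨p.src, p.μ⟩ : PBond P j) ∈ Λ ∧ (⟨p.src.shift p.μ, p.ν⟩ : PBond P j) ∈ Λ ∧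
      (⟨p.src.shift p.ν, p.μ⟩ : PBond P j) ∈ Λ ∧ (⟨p.src, p.ν⟩ : PBond P j) ∈ Λ)
    (V : GaugeField P j (SUN N)) (x : BlockChartSU N Λ) (c : ℝ) :
    wilsonU hPu (updateFinset V Λ (expFibreChartSU Λ 1 (c • x))) =
      Pu.sup' hPu fun p => ‖wordExp (scale c (if hp : p ∈ Pu then
        gens Λ p (hPuΛ p hp).1 (hPuΛ p hp).2.1 (hPuΛ p hp).2.2.1 (hPuΛ p hp).2.2.2 x else [])) - 1‖ := by
  unfold wilsonU
  refine Finset.sup'_congr hPu rfl fun p hp => ?_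
  rw [dif_pos hp, ← (wilson_dictionary_specialUnitaryGroup _).2, coe_plaqHol_eq_wordEval, wordEval_plaqWord_smul,
    wordEval_plaqWord_eq_wordExp]

/-! ## §4 (M1)₀ realized for `SU(N)` — with a Λ-blind exterior factor riding free, and bare -/

/-- **(M1)₀ REALIZED FOR `G = SU(N)`, EVERY `N`, WITH A Λ-BLIND EXTERIOR FACTOR RIDING FREE.**  The density
`wilsonF · Gx` for ANY measurable factor `Gx ≤ 1` that does not read the block bonds (`Gx (V[Λ := y]) = Gx V` — e.g. a
product of exterior co-tests, an exterior Boltzmann weight): the factor is constant on every section, so (S-i)₀ and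
(S-ii)₀ are untouched and the constant is the bare one (the `SU(N)` counterpart of
`ShellMeasureWilsonExterior.slotAntiConcentration_wilson_su2_exterior`).  Hypotheses and constant: see the module
docstring. [folklore] -/
theorem slotAntiConcentration_wilson_suN_exterior {S : ℝ} (hS : 0 ≤ S) (hS4 : S ≤ 1 / 4)
    {Pu : Finset (Plaq P j)} (hPu : Pu.Nonempty)
    (hPuΛ : ∀ p ∈ Pu, (⟨p.src, p.μ⟩ : PBond P j) ∈ Λ ∧ (⟨p.src.shift p.μ, p.ν⟩ : PBond P j) ∈ Λ ∧
      (⟨p.src.shift p.ν, p.μ⟩ : PBond P j) ∈ Λ ∧ (⟨p.src, p.ν⟩ : PBond P j) ∈ Λ)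
    (Pw : Finset (Plaq P j)) {β θ δ ρ : ℝ} (hβ : 0 ≤ β) (hθ : 0 < θ) (hδ0 : 0 ≤ δ) (hδ1 : δ < 1) (hρ0 : 0 ≤ ρ)
    (hρ : ρ ≤ (1 - δ) / 2) (hSM : 4 * (4 * S) ^ 2 * Real.exp (2 * (4 * S)) ≤ δ * θ)
    (Gx : GaugeField P j (SUN N) → ℝ≥0∞) (hGm : Measurable Gx)
    (hGb : ∀ (V : GaugeField P j (SUN N)) (y : ↥Λ → SUN N), Gx (updateFinset V Λ y) = Gx V) (hG1 : ∀ V, Gx V ≤ 1) :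
    SlotAntiConcentration ((fieldMeasure P j (SUN N)).withDensity fun V => wilsonF Λ S β Pw V * Gx V) (wilsonU hPu)
      θ ρ (2 * (((Λ.card * dimSU N : ℕ) : ℝ) + β * ∑ _p ∈ Pw, (4 * S) * (8 + 4 * (4 * S))) / (1 - δ)) := by
  -- the window radius is below `π`
  have hSπ : S ≤ Real.pi := by linarith [Real.pi_gt_three]
  have h4S1 : 4 * S ≤ 1 := by linarith
  -- the depth
  have h1δ : 0 < 1 - δ := by linarith
  set ρ' := ρ / (1 - δ) with hρ'
  have hρ'0 : 0 ≤ ρ' := div_nonneg hρ0 h1δ.le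
  have hρ'2 : ρ' ≤ 1 / 2 := by rw [hρ', div_le_iff₀ h1δ]; linarith
  set a := -Real.log (1 - ρ') with ha
  have hc0 : 0 < 1 - ρ' := by linarith
  have hc1 : 1 - ρ' ≤ 1 := by linarith
  have hexp : Real.exp (-a) = 1 - ρ' := by rw [ha, neg_neg, Real.exp_log hc0]
  have ha0 : 0 ≤ a := by rw [ha, neg_nonneg]; exact Real.log_nonpos hc0.le hc1
  have ha2 : a ≤ 2 * ρ' := T4ShellMeasureFibre.neg_log_one_sub_le hρ'0 hρ'2
  have h1ca : 1 - (1 - ρ') ≤ a := by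
    have h := Real.log_le_sub_one_of_pos hc0
    rw [ha]; linarith
  set Bf := β * ∑ _p ∈ Pw, (4 * S) * (8 + 4 * (4 * S)) with hBf
  have hBf0 : 0 ≤ Bf := by rw [hBf]; exact mul_nonneg hβ (Finset.sum_nonneg fun p _ => by positivity)
  have hN : 0 < (matrixTrace (n := Fin N)).N := matrixTrace_N_pos
  -- the factored density: window factorisation, measurability, finiteness
  have hFw : ∀ (V : GaugeField P j (SUN N)) (y : ↥Λ → SUN N),
      wilsonF Λ S β Pw (updateFinset V Λ y) * Gx (updateFinset V Λ y) =
        windowSU Λ ((fun _ => (1 : GaugeField P j (SUN N))) V) S y * (wilsonR Λ β Pw V y * Gx V) := by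
    intro V y
    rw [wilsonF_updateFinset, hGb, mul_assoc]
  have hF1 : ∀ V, wilsonF Λ S β Pw V * Gx V ≤ 1 := fun V =>
    calc wilsonF Λ S β Pw V * Gx V ≤ 1 * 1 := mul_le_mul' (wilsonF_le_one Λ hβ Pw V) (hG1 V)
      _ = 1 := one_mul _
  have hfin : ∀ V : GaugeField P j (SUN N),
      ((blockLaw Λ).withDensity fun y : ↥Λ → SUN N =>
        wilsonF Λ S β Pw (updateFinset V Λ y) * Gx (updateFinset V Λ y)) univ ≠ ∞ := by
    intro V
    rw [withDensity_apply _ MeasurableSet.univ, Measure.restrict_univ]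
    refine ne_top_of_le_ne_top (b := (blockLaw (G := SUN N) Λ) univ) (measure_ne_top _ _) ?_
    calc ∫⁻ y, wilsonF Λ S β Pw (updateFinset V Λ y) * Gx (updateFinset V Λ y) ∂blockLaw Λ
        ≤ ∫⁻ _y, 1 ∂blockLaw (G := SUN N) Λ := lintegral_mono fun y => hF1 _
      _ = (blockLaw (G := SUN N) Λ) univ := lintegral_one
  refine slotAntiConcentration_realized_suN_le Λ hS hSπ (fun _ => (1 : GaugeField P j (SUN N)))
    (R := fun V y => wilsonR Λ β Pw V y * Gx V) (fun V => (measurable_wilsonR Λ β Pw V).mul measurable_const)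
    (F := fun V => wilsonF Λ S β Pw V * Gx V) ((measurable_wilsonF Λ S β Pw).mul hGm)
    hFw hfin (measurable_wilsonU hPu) (a := a) (Bf := Bf) hθ.le hρ0 ha0 ?_ ?_ ?_
  · -- the constant
    have hn : (0 : ℝ) ≤ ((Λ.card * dimSU N : ℕ) : ℝ) + Bf := by positivity
    calc (((Λ.card * dimSU N : ℕ) : ℝ) + Bf) * a ≤ (((Λ.card * dimSU N : ℕ) : ℝ) + Bf) * (2 * ρ') :=
        mul_le_mul_of_nonneg_left ha2 hn
      _ = 2 * (((Λ.card * dimSU N : ℕ) : ℝ) + Bf) / (1 - δ) * ρ := by rw [hρ']; field_simp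
  · -- (S-i)₀ the core map
    intro V x hx _ hux
    rw [hexp]
    have h1 : wilsonU hPu (updateFinset V Λ (expFibreChartSU Λ 1 x)) =
        wilsonU hPu (updateFinset V Λ (expFibreChartSU Λ 1 ((1 : ℝ) • x))) := by rw [one_smul]
    rw [h1, wilsonU_chart_smul Λ hPu hPuΛ] at hux
    rw [wilsonU_chart_smul Λ hPu hPuΛ]
    simp only [scale_one] at hux
    refine coreMap_sup hPu _ (δ := δ) hc0 hc1 (fun p hp => ?_) hθ (fun p hp => ?_) ?_ hux
    · rw [dif_pos hp]
      exact (normSum_gens_le Λ hx p _ _ _ _).trans h4S1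
    · rw [dif_pos hp]
      exact (interpConst_mono (normSum_nonneg _) (normSum_gens_le Λ hx p _ _ _ _)).trans hSM
    · rw [hρ']; exact depth_admissible hδ0 hδ1 hρ0
  · -- (S-ii)₀ the ray-weight loss of the sectioned Wilson weight; the exterior factor rides free
    intro V x hx _ _
    rw [hexp]
    suffices h : wilsonR Λ β Pw V (expFibreChartSU Λ 1 x) ≤
        ENNReal.ofReal (Real.exp (Bf * a)) * wilsonR Λ β Pw V (expFibreChartSU Λ 1 ((1 - ρ') • x)) by
      calc wilsonR Λ β Pw V (expFibreChartSU Λ 1 x) * Gx V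
          ≤ ENNReal.ofReal (Real.exp (Bf * a)) * wilsonR Λ β Pw V (expFibreChartSU Λ 1 ((1 - ρ') • x)) * Gx V :=
            mul_le_mul' h le_rfl
        _ = _ := by rw [mul_assoc]
    unfold wilsonR
    have h1 : expFibreChartSU Λ (1 : GaugeField P j (SUN N)) x = expFibreChartSU Λ 1 ((1 : ℝ) • x) := by
      rw [one_smul]
    rw [h1, wilsonSum_chart_smul, wilsonSum_chart_smul]
    obtain hdata := fun p => plaqWord_data Λ hS V hx p
    have hdiff := wilsonAction_contract_sub_le (matrixTrace (n := Fin N)) hN Pw (fun p => plaqWord Λ V x p)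
      (fun p _ => (hdata p).1) (sb := fun _ => 4 * S) (db := fun _ => 8) (fun p _ => (hdata p).2.1)
      (fun p _ => h4S1) (fun p _ => (hdata p).2.2) hβ hc0.le hc1
    rw [← hBf] at hdiff
    have hle : β * ∑ p ∈ Pw, (1 - (matrixTrace (n := Fin N)).τ (wordEval (1 - ρ') (plaqWord Λ V x p)) /
          (matrixTrace (n := Fin N)).N) -
        β * ∑ p ∈ Pw, (1 - (matrixTrace (n := Fin N)).τ (wordEval 1 (plaqWord Λ V x p)) /
          (matrixTrace (n := Fin N)).N) ≤ Bf * a :=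
      hdiff.trans (by nlinarith [mul_le_mul_of_nonneg_left h1ca hBf0])
    rw [← ENNReal.ofReal_mul (Real.exp_pos _).le, ← Real.exp_add]
    exact ENNReal.ofReal_le_ofReal (Real.exp_le_exp.2 (by linarith))

/-- **(M1)₀ REALIZED FOR `G = SU(N)`, EVERY `N`** (the bare windowed Wilson block; exterior factor `1`) — see the
module docstring. [folklore] -/
theorem slotAntiConcentration_wilson_suN {S : ℝ} (hS : 0 ≤ S) (hS4 : S ≤ 1 / 4)
    {Pu : Finset (Plaq P j)} (hPu : Pu.Nonempty)
    (hPuΛ : ∀ p ∈ Pu, (⟨p.src, p.μ⟩ : PBond P j) ∈ Λ ∧ (⟨p.src.shift p.μ, p.ν⟩ : PBond P j) ∈ Λ ∧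
      (⟨p.src.shift p.ν, p.μ⟩ : PBond P j) ∈ Λ ∧ (⟨p.src, p.ν⟩ : PBond P j) ∈ Λ)
    (Pw : Finset (Plaq P j)) {β θ δ ρ : ℝ} (hβ : 0 ≤ β) (hθ : 0 < θ) (hδ0 : 0 ≤ δ) (hδ1 : δ < 1) (hρ0 : 0 ≤ ρ)
    (hρ : ρ ≤ (1 - δ) / 2) (hSM : 4 * (4 * S) ^ 2 * Real.exp (2 * (4 * S)) ≤ δ * θ) :
    SlotAntiConcentration ((fieldMeasure P j (SUN N)).withDensity (wilsonF Λ S β Pw)) (wilsonU hPu) θ ρ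
      (2 * (((Λ.card * dimSU N : ℕ) : ℝ) + β * ∑ _p ∈ Pw, (4 * S) * (8 + 4 * (4 * S))) / (1 - δ)) := by
  have h := slotAntiConcentration_wilson_suN_exterior (N := N) Λ hS hS4 hPu hPuΛ Pw hβ hθ hδ0 hδ1 hρ0 hρ hSM
    (fun _ => (1 : ℝ≥0∞)) measurable_const (fun _ _ => rfl) (fun _ => le_rfl)
  have h1 : (fun V : GaugeField P j (SUN N) => wilsonF Λ S β Pw V * 1) = wilsonF Λ S β Pw :=
    funext fun _ => mul_one _
  rwa [h1] at h

end Summit.QuantumFields.BalabanUV.T4Continuum.ShellMeasureWilsonRealizedSUN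

end
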